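import Literature.AlgebraicGeometry.AbelianSchemes.TupleIsoAtOfFibreIso                         -- ★ `tupleRel_trans`, `RingAction`, `baseChangeHom`
import Literature.AlgebraicGeometry.AbelianSchemes.PolarizedAbelianSchemeWithLevelBaseChangeUnique -- ★ `isBaseChangeVia_id_of_comp_eq`, `IsBaseChangeVia.exists_iso_comp_eq`
import Literature.AlgebraicGeometry.AbelianSchemes.PolarizedAbelianSchemeWithLevelBaseChange       -- ★ `DualPair.baseChange_hat_isBaseChangeVia`, `…nonempty_pullback_map_P_iso_baseChange_P`
import Literature.AlgebraicGeometry.AbelianSchemes.AbelianSchemeFixedPowBaseChange                -- ★ `RingAction.baseChange`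
import HarnessLib

/-!
# Pull-back relations of PEL tuples: the canonical one, UNIQUENESS up to an isomorphism of tuples, and the POINTWISE `gen_iso` of a global relation

Topic `AlgebraicGeometry/AbelianSchemes`; namespace `Literature.AlgebraicGeometry.AbelianSchemes.AbelianSchemeOver`.  THEOREMS ONLY (no
definition, no instance, no notation, no named fact, no `sorry`).  Cell `hodgecm-mathlib` (D-0151), P6 «MOD programme» (crux hLiu418 =
stmt-HodgeConjecture-24832, `--supports`, count-neutral); P-LINE ED. 2 «GLOBAL SPREAD» provenance (LEAD F0P6-plan (g3) «M-47»∕«M-50», desk v6a :140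
«INTENDED STRENGTHENING: ONE GLOBAL isomorphism of PEL tuples OVER THE GENERIC FIBRE … this pointwise form is then a lemma»; GEN heir A-p18 «=»).
The UNBUNDLED six-clause currency (level ∕ `X`, `X̂`, Poincaré, `λ`, `𝒪`-action) of ★ `TupleIsoAtOfFibreIso` (`tupleRel_trans`), i.e. the cell letters
`tupleIsoAt` ∕ `TupleIsoVia` ∕ `TupleIsoAt₂` with a general base map in place of `𝟙 T`.  HC_CM is proved only modulo the printed citations until rung 0
closes; nothing here is about HC.

THE MATHEMATICS ([MumfordFogartyKirwan1994] Ch. 7 §2 Def. 7.2: the moduli functor is a functor BY PULL-BACK `(X, λ, σᵢ) ↦ (X ×_S T, …)`, values = triples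
UP TO ISOMORPHISM; [GortzWedhorn2020] Prop. 4.16, (4.7): fibre products are unique up to unique isomorphism and transitive).
* §1 `tupleRel_baseChange_fst` — THE CANONICAL RELATION: the chosen base change `(𝒜 ×_Y T, ι_T, Â ×_Y T, 𝒫_T, λ_T, lvl_T)` IS a pull-back of
  `(𝒜, ι, Â, 𝒫, λ, lvl)` along `s` via the first projections (★ `LevelStructure.baseChange_isBaseChangeVia`, ★ `DualPair.baseChange_hat_isBaseChangeVia`,
  ★ `DualPair.nonempty_pullback_map_P_iso_baseChange_P`, ★ `Polarization.baseChange_lam_left_comp_fst`, ★ `baseChangeHom_left_comp_fst`).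
* §2 `exists_tupleRel_id_of_tupleRel_of_tupleRel` — UNIQUENESS: two tuples over `T` that are both pull-backs of one tuple over `S` along the same
  `f` (via `(G₁, Ĝ₁)`, `(G₂, Ĝ₂)`) are ISOMORPHIC AS TUPLES along `𝟙 T` — the comparison isomorphisms `H`, `Ĥ` of the cartesian squares
  (★ `IsBaseChangeVia.exists_iso_comp_eq`) satisfy all six clauses (the unbundled twin, WITH action, of ★
  `PolarizedAbelianSchemeWithLevel.IsBaseChangeVia.exists_isBaseChangeVia_id_of_isBaseChangeVia`, same proof).
* §3 `exists_tupleIsoVia_of_tupleRel` — POINTWISE `gen_iso` OF A GLOBAL RELATION: if the tuple `(𝒜₂, ι₂, …)` over `Y′` is a pull-back of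
  `(𝒜₁, ι₁, …)` over `Y` along `π : Y′ → Y` (six clauses via `(G, Ĝ)`), then at EVERY point `t : T → Y′` the tuples `π^*𝒜₁` and `𝒜₂` are
  isomorphic at `t` — the body of the cell letter `TupleIsoVia t (𝒜₁.baseChange π) (ρ₁.baseChange π) … 𝒜₂ ρ₂ …` (= `PELSpreadAt.gen_iso` with
  `𝒜₁ := univ`, `π := ιη`, `𝒜₂ := E.P.A`, `t := ℓ_{e′} y`): both `(π^*𝒜₁)_t` and `(𝒜₂)_t` are pull-backs of `𝒜₁` along `t ≫ π` (§1 twice + ★ `tupleRel_trans`), so §2.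

## References
* [MumfordFogartyKirwan1994] D. Mumford, J. Fogarty, F. Kirwan, *Geometric Invariant Theory*, 3rd ed. (1994), Ch. 7 §2 Definition 7.2 (p. 129), Definition 7.3 (p. 130).
* [GortzWedhorn2020] U. Görtz, T. Wedhorn, *Algebraic Geometry I*, 2nd ed. (2020), Prop. 4.16 (p. 101), Section (4.7) (pp. 107–108).
* [RapoportSmithlingZhang2020Diagonal] M. Rapoport, B. Smithling, W. Zhang, *Arithmetic diagonal cycles on unitary Shimura varieties*, Compos. Math. 156 (2020), §4.1 (p. 17).
-/

set_option autoImplicit false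

noncomputable section

-- Mathlib's `Over`/pull-back API is stated across semireducible wrappers (as in the ★ `AbelianSchemes/*` files).
set_option backward.isDefEq.respectTransparency false

universe u

open CategoryTheory CategoryTheory.Limits AlgebraicGeometry MonoidalCategory
open scoped MonObj

namespace Literature.AlgebraicGeometry.AbelianSchemes

namespace AbelianSchemeOver

/-! ### §1 The canonical six-clause relation of the chosen base change -/

section Canonical

variable {Y T : Scheme.{u}} (𝒜 : AbelianSchemeOver Y) {O : Type*} [CommRing O] (ρ : RingAction O 𝒜) (D : 𝒜.DualPair)
  (pol : 𝒜.Polarization D) {g n : ℕ} (lvl : 𝒜.LevelStructure g n) (s : T ⟶ Y)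

/-- **THE CHOSEN BASE CHANGE IS A PULL-BACK OF TUPLES along `s` via the first projections** (all six clauses: level ∕ `X`, `X̂`, Poincaré,
`λ`, `𝒪`-action) — [MumfordFogartyKirwan1994] Def. 7.2 «`𝒜(f)(X, λ, σᵢ) = (X ×_S T, …)`», assembled from the ★ component relations.
[cite: MumfordFogartyKirwan1994, Ch. 7 §2 Definition 7.2 (p. 129)] [cite: GortzWedhorn2020, Section (4.7) (pp. 107–108)] -/
theorem tupleRel_baseChange_fst :
    (lvl.baseChange s).IsBaseChangeVia lvl s (pullback.fst 𝒜.X.hom s) ∧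
      (D.baseChange s).hat.IsBaseChangeVia D.hat s (pullback.fst D.hat.X.hom s) ∧
      (∃ (wG : (𝒜.baseChange s).X.hom ≫ s = pullback.fst 𝒜.X.hom s ≫ 𝒜.X.hom)
          (wĜ : (D.baseChange s).hat.X.hom ≫ s = pullback.fst D.hat.X.hom s ≫ D.hat.X.hom),
        Nonempty ((Scheme.Modules.pullback
          (pullback.map (𝒜.baseChange s).X.hom (D.baseChange s).hat.X.hom 𝒜.X.hom D.hat.X.hom
            (pullback.fst 𝒜.X.hom s) (pullback.fst D.hat.X.hom s) s wG wĜ)).obj D.P ≅ (D.baseChange s).P)) ∧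
      (pol.baseChange s).lam.left ≫ pullback.fst D.hat.X.hom s = pullback.fst 𝒜.X.hom s ≫ pol.lam.left ∧
      ∀ a : O, (baseChangeHom (ρ.i a) s).left ≫ pullback.fst 𝒜.X.hom s = pullback.fst 𝒜.X.hom s ≫ (ρ.i a).left :=
  ⟨lvl.baseChange_isBaseChangeVia s, D.baseChange_hat_isBaseChangeVia s,
    ⟨pullback.condition.symm, pullback.condition.symm, D.nonempty_pullback_map_P_iso_baseChange_P s _ _⟩,
    pol.baseChange_lam_left_comp_fst s, fun a => baseChangeHom_left_comp_fst (ρ.i a) s⟩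

end Canonical

/-! ### §2 Uniqueness: two pull-backs of one tuple along the same map are isomorphic AS TUPLES -/

section Unique

variable {S T : Scheme.{u}} {A : AbelianSchemeOver S} {A₁ A₂ : AbelianSchemeOver T}
  {D : A.DualPair} {D₁ : A₁.DualPair} {D₂ : A₂.DualPair}
  {lam : A.X ⟶ D.hat.X} {lam₁ : A₁.X ⟶ D₁.hat.X} {lam₂ : A₂.X ⟶ D₂.hat.X}
  {g n : ℕ} {φ : A.LevelStructure g n} {φ₁ : A₁.LevelStructure g n} {φ₂ : A₂.LevelStructure g n}
  {O : Type*} {act : O → (A.X ⟶ A.X)} {act₁ : O → (A₁.X ⟶ A₁.X)} {act₂ : O → (A₂.X ⟶ A₂.X)}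
  {f : T ⟶ S} {G₁ : A₁.X.left ⟶ A.X.left} {Ĝ₁ : D₁.hat.X.left ⟶ D.hat.X.left}
  {G₂ : A₂.X.left ⟶ A.X.left} {Ĝ₂ : D₂.hat.X.left ⟶ D.hat.X.left}

/-- **PULL-BACKS OF TUPLES ARE UNIQUE UP TO AN ISOMORPHISM OF TUPLES** (with `𝒪`-action; [MumfordFogartyKirwan1994] Def. 7.2: `𝒜(f)` is well defined on
isomorphism classes).  If `(G₁, Ĝ₁)` and `(G₂, Ĝ₂)` exhibit the tuples `(A₁, ι₁, Â₁, 𝒫₁, λ₁, φ₁)` and `(A₂, ι₂, …)` over `T` as pull-backs of `(A, ι, Â, 𝒫, λ, φ)`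
over `S` along the same `f`, then the comparison isomorphisms `H : X₂ ≅ X₁`, `Ĥ : X̂₂ ≅ X̂₁` of the cartesian squares (`H ≫ G₁ = G₂`, `Ĥ ≫ Ĝ₁ = Ĝ₂`) satisfy
ALL SIX CLAUSES along `𝟙 T` from tuple 2 to tuple 1: level ∕ `X` and `X̂` (★ `isBaseChangeVia_id_of_comp_eq`), Poincaré (`(H × Ĥ)^*𝒫₁ ≅ (H × Ĥ)^*(G₁ × Ĝ₁)^*𝒫 =
(G₂ × Ĝ₂)^*𝒫 ≅ 𝒫₂`), `λ` and the ACTION (compared after `G₁` and over `T`, i.e. as maps into the pull-back `X₁` resp. `X̂₁`).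
[cite: MumfordFogartyKirwan1994, Ch. 7 §2 Definition 7.2 (p. 129) and Definition 7.3 (p. 130)] [cite: GortzWedhorn2020, Prop. 4.16 (p. 101) and Section (4.7) (pp. 107–108)] -/
theorem exists_tupleRel_id_of_tupleRel_of_tupleRel
    (h₁ : φ₁.IsBaseChangeVia φ f G₁ ∧ D₁.hat.IsBaseChangeVia D.hat f Ĝ₁ ∧
      (∃ (wG : A₁.X.hom ≫ f = G₁ ≫ A.X.hom) (wĜ : D₁.hat.X.hom ≫ f = Ĝ₁ ≫ D.hat.X.hom),
        Nonempty ((Scheme.Modules.pullback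
          (pullback.map A₁.X.hom D₁.hat.X.hom A.X.hom D.hat.X.hom G₁ Ĝ₁ f wG wĜ)).obj D.P ≅ D₁.P)) ∧
      lam₁.left ≫ Ĝ₁ = G₁ ≫ lam.left ∧ ∀ a : O, (act₁ a).left ≫ G₁ = G₁ ≫ (act a).left)
    (h₂ : φ₂.IsBaseChangeVia φ f G₂ ∧ D₂.hat.IsBaseChangeVia D.hat f Ĝ₂ ∧
      (∃ (wG : A₂.X.hom ≫ f = G₂ ≫ A.X.hom) (wĜ : D₂.hat.X.hom ≫ f = Ĝ₂ ≫ D.hat.X.hom),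
        Nonempty ((Scheme.Modules.pullback
          (pullback.map A₂.X.hom D₂.hat.X.hom A.X.hom D.hat.X.hom G₂ Ĝ₂ f wG wĜ)).obj D.P ≅ D₂.P)) ∧
      lam₂.left ≫ Ĝ₂ = G₂ ≫ lam.left ∧ ∀ a : O, (act₂ a).left ≫ G₂ = G₂ ≫ (act a).left) :
    ∃ (H : A₂.X.left ⟶ A₁.X.left) (Ĥ : D₂.hat.X.left ⟶ D₁.hat.X.left),
      IsIso H ∧ IsIso Ĥ ∧ H ≫ G₁ = G₂ ∧ Ĥ ≫ Ĝ₁ = Ĝ₂ ∧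
      (φ₂.IsBaseChangeVia φ₁ (𝟙 T) H ∧ D₂.hat.IsBaseChangeVia D₁.hat (𝟙 T) Ĥ ∧
        (∃ (wG : A₂.X.hom ≫ 𝟙 T = H ≫ A₁.X.hom) (wĜ : D₂.hat.X.hom ≫ 𝟙 T = Ĥ ≫ D₁.hat.X.hom),
          Nonempty ((Scheme.Modules.pullback
            (pullback.map A₂.X.hom D₂.hat.X.hom A₁.X.hom D₁.hat.X.hom H Ĥ (𝟙 T) wG wĜ)).obj D₁.P ≅ D₂.P)) ∧
        lam₂.left ≫ Ĥ = H ≫ lam₁.left ∧ ∀ a : O, (act₂ a).left ≫ H = H ≫ (act₁ a).left) := by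
  obtain ⟨hl₁, hh₁, ⟨wG₁, wĜ₁, ⟨e₁⟩⟩, hlam₁, hact₁⟩ := h₁
  obtain ⟨hl₂, hh₂, ⟨wG₂, wĜ₂, ⟨e₂⟩⟩, hlam₂, hact₂⟩ := h₂
  -- the comparison isomorphisms of the `X`- and `X̂`-squares
  obtain ⟨H, hHG, hHw⟩ := hl₁.1.exists_iso_comp_eq hl₂.1
  obtain ⟨Ĥ, hĤG, hĤw⟩ := hh₁.exists_iso_comp_eq hh₂
  obtain ⟨-, hpb₁, -, -⟩ := id hl₁.1
  obtain ⟨-, hpbh₁, -, -⟩ := id hh₁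
  have wG : A₂.X.hom ≫ 𝟙 T = H.hom ≫ A₁.X.hom := by rw [Category.comp_id, hHw]
  have wĜ : D₂.hat.X.hom ≫ 𝟙 T = Ĥ.hom ≫ D₁.hat.X.hom := by rw [Category.comp_id, hĤw]
  refine ⟨H.hom, Ĥ.hom, inferInstance, inferInstance, hHG, hĤG,
    LevelStructure.isBaseChangeVia_id_of_comp_eq hl₁ hl₂ H.hom hHG hHw,
    isBaseChangeVia_id_of_comp_eq hh₁ hh₂ Ĥ.hom hĤG hĤw, ⟨wG, wĜ, ⟨?_⟩⟩, ?_, fun a => ?_⟩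
  · -- Poincaré: `(H × Ĥ)^* 𝒫₁ ≅ (H × Ĥ)^* (G₁ × Ĝ₁)^* 𝒫 ≅ ((H × Ĥ) ≫ (G₁ × Ĝ₁))^* 𝒫 = (G₂ × Ĝ₂)^* 𝒫 ≅ 𝒫₂`
    have hcomp : pullback.map A₂.X.hom D₂.hat.X.hom A₁.X.hom D₁.hat.X.hom H.hom Ĥ.hom (𝟙 T) wG wĜ ≫
          pullback.map A₁.X.hom D₁.hat.X.hom A.X.hom D.hat.X.hom G₁ Ĝ₁ f wG₁ wĜ₁ =
        pullback.map A₂.X.hom D₂.hat.X.hom A.X.hom D.hat.X.hom G₂ Ĝ₂ f wG₂ wĜ₂ := by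
      apply pullback.hom_ext
      · rw [Category.assoc, pullback.lift_fst, ← Category.assoc, pullback.lift_fst, Category.assoc, hHG, pullback.lift_fst]
      · rw [Category.assoc, pullback.lift_snd, ← Category.assoc, pullback.lift_snd, Category.assoc, hĤG, pullback.lift_snd]
    exact (Scheme.Modules.pullback
        (pullback.map A₂.X.hom D₂.hat.X.hom A₁.X.hom D₁.hat.X.hom H.hom Ĥ.hom (𝟙 T) wG wĜ)).mapIso e₁.symm ≪≫
      (Scheme.Modules.pullbackComp
        (pullback.map A₂.X.hom D₂.hat.X.hom A₁.X.hom D₁.hat.X.hom H.hom Ĥ.hom (𝟙 T) wG wĜ)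
        (pullback.map A₁.X.hom D₁.hat.X.hom A.X.hom D.hat.X.hom G₁ Ĝ₁ f wG₁ wĜ₁)).app D.P ≪≫
      (Scheme.Modules.pullbackCongr hcomp).app D.P ≪≫ e₂
  · -- `λ`: compare after `Ĝ₁` and over `T`, i.e. as maps into `X̂₁ = X̂ ×_S T`
    apply hpbh₁.hom_ext
    · rw [Category.assoc, hĤG, hlam₂, Category.assoc, hlam₁, ← Category.assoc, hHG]
    · rw [Category.assoc, hĤw, Category.assoc, Over.w lam₁, hHw, Over.w lam₂]
  · -- action: compare after `G₁` and over `T`, i.e. as maps into `X₁ = X ×_S T`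
    apply hpb₁.hom_ext
    · rw [Category.assoc, hHG, hact₂ a, Category.assoc, hact₁ a, ← Category.assoc, hHG]
    · rw [Category.assoc, hHw, Category.assoc, Over.w (act₁ a), hHw, Over.w (act₂ a)]

end Unique

/-! ### §3 The pointwise `gen_iso` of a global pull-back relation -/

section Pointwise

variable {Y Y' T : Scheme.{u}} {O : Type*} [CommRing O]
  (𝒜₁ : AbelianSchemeOver Y) (ρ₁ : RingAction O 𝒜₁) (D₁ : 𝒜₁.DualPair) (pol₁ : 𝒜₁.Polarization D₁)
  {g N : ℕ} (lvl₁ : 𝒜₁.LevelStructure g N)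
  (𝒜₂ : AbelianSchemeOver Y') (ρ₂ : RingAction O 𝒜₂) (D₂ : 𝒜₂.DualPair) (pol₂ : 𝒜₂.Polarization D₂)
  (lvl₂ : 𝒜₂.LevelStructure g N) (π : Y' ⟶ Y) {G : 𝒜₂.X.left ⟶ 𝒜₁.X.left} {Ĝ : D₂.hat.X.left ⟶ D₁.hat.X.left}

/-- **POINTWISE `gen_iso` OF A GLOBAL RELATION.**  If the tuple `(𝒜₂, ι₂, Â₂, 𝒫₂, λ₂, lvl₂)` over `Y′` is a pull-back of `(𝒜₁, ι₁, Â₁, 𝒫₁, λ₁, lvl₁)` over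
`Y` along `π : Y′ → Y` via `(G, Ĝ)` (six clauses — e.g. the P-line՚s GLOBAL SPREAD provenance «the E-tuple IS the generic fibre of the spread tuple»), then
at EVERY point `t : T → Y′` the pulled-back tuples `π^*𝒜₁` and `𝒜₂` are ISOMORPHIC AT `t`: there are `G′`, `Ĝ′` satisfying the six clauses along `𝟙 T`
between `(π^*𝒜₁) ×_{Y′} t` and `𝒜₂ ×_{Y′} t` — VERBATIM the body of the cell letter `TupleIsoVia t (𝒜₁.baseChange π) (ρ₁.baseChange π) (D₁.baseChange π)
(pol₁.baseChange π) (lvl₁.baseChange π) 𝒜₂ ρ₂ D₂ pol₂ lvl₂ G′ Ĝ′` (so `TupleIsoAt₂ t …` ∕ `PELSpreadAt.gen_iso e′ y` close by `exact`).  Proof: both are pull-backs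
of `𝒜₁` along `t ≫ π` (§1 twice, composed by ★ `tupleRel_trans`, resp. §1 composed with the hypothesis), hence §2.
[cite: MumfordFogartyKirwan1994, Ch. 7 §2 Definition 7.2 (p. 129) and Definition 7.3 (p. 130)] [cite: GortzWedhorn2020, Prop. 4.16 (p. 101) and Section (4.7) (pp. 107–108)]
[cite: RapoportSmithlingZhang2020Diagonal, §4.1 p. 17] -/
theorem exists_tupleIsoVia_of_tupleRel
    (h : lvl₂.IsBaseChangeVia lvl₁ π G ∧ D₂.hat.IsBaseChangeVia D₁.hat π Ĝ ∧
      (∃ (wG : 𝒜₂.X.hom ≫ π = G ≫ 𝒜₁.X.hom) (wĜ : D₂.hat.X.hom ≫ π = Ĝ ≫ D₁.hat.X.hom),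
        Nonempty ((Scheme.Modules.pullback
          (pullback.map 𝒜₂.X.hom D₂.hat.X.hom 𝒜₁.X.hom D₁.hat.X.hom G Ĝ π wG wĜ)).obj D₁.P ≅ D₂.P)) ∧
      pol₂.lam.left ≫ Ĝ = G ≫ pol₁.lam.left ∧ ∀ a : O, (ρ₂.i a).left ≫ G = G ≫ (ρ₁.i a).left)
    (t : T ⟶ Y') :
    ∃ (G' : ((𝒜₁.baseChange π).baseChange t).X.left ⟶ (𝒜₂.baseChange t).X.left)
      (Ĝ' : ((D₁.baseChange π).baseChange t).hat.X.left ⟶ (D₂.baseChange t).hat.X.left),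
      ((lvl₁.baseChange π).baseChange t).IsBaseChangeVia (lvl₂.baseChange t) (𝟙 T) G' ∧
      ((D₁.baseChange π).baseChange t).hat.IsBaseChangeVia (D₂.baseChange t).hat (𝟙 T) Ĝ' ∧
      (∃ (wG : ((𝒜₁.baseChange π).baseChange t).X.hom ≫ 𝟙 T = G' ≫ (𝒜₂.baseChange t).X.hom)
          (wĜ : ((D₁.baseChange π).baseChange t).hat.X.hom ≫ 𝟙 T = Ĝ' ≫ (D₂.baseChange t).hat.X.hom),
        Nonempty ((Scheme.Modules.pullback
          (pullback.map ((𝒜₁.baseChange π).baseChange t).X.hom ((D₁.baseChange π).baseChange t).hat.X.hom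
            (𝒜₂.baseChange t).X.hom (D₂.baseChange t).hat.X.hom G' Ĝ' (𝟙 T) wG wĜ)).obj (D₂.baseChange t).P ≅
          ((D₁.baseChange π).baseChange t).P)) ∧
      ((pol₁.baseChange π).baseChange t).lam.left ≫ Ĝ' = G' ≫ (pol₂.baseChange t).lam.left ∧
      ∀ a : O, (baseChangeHom ((ρ₁.baseChange π).i a) t).left ≫ G' = G' ≫ (baseChangeHom (ρ₂.i a) t).left := by
  -- `(π^*𝒜₁) ×_{Y′} t` is a pull-back of `𝒜₁` along `t ≫ π` (§1 twice)
  have r₁ := tupleRel_trans (tupleRel_baseChange_fst (𝒜₁.baseChange π) (ρ₁.baseChange π) (D₁.baseChange π) (pol₁.baseChange π)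
    (lvl₁.baseChange π) t) (tupleRel_baseChange_fst 𝒜₁ ρ₁ D₁ pol₁ lvl₁ π)
  -- `𝒜₂ ×_{Y′} t` is a pull-back of `𝒜₁` along `t ≫ π` (§1, then the hypothesis)
  have r₂ := tupleRel_trans (tupleRel_baseChange_fst 𝒜₂ ρ₂ D₂ pol₂ lvl₂ t) h
  obtain ⟨H, Ĥ, -, -, -, -, hrel⟩ := exists_tupleRel_id_of_tupleRel_of_tupleRel r₂ r₁
  exact ⟨H, Ĥ, hrel⟩

end Pointwise

end AbelianSchemeOver

end Literature.AlgebraicGeometry.AbelianSchemes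

end
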